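import Summits.HodgeConjecture.HodgeConjecture.Theorems.HodgeClassesAbsolutelyTate
import Literature.AlgebraicGeometry.Motives.AbsolutelyTateClasses
import HarnessLib

/-!
# `HodgeClassesAbsolutelyTate` unfolded into the Literature vocabulary

Glue, all proved, between the registered conjecture leaf
`Summit.HodgeConjecture.HodgeConjecture.HodgeClassesAbsolutelyTate` (Ogus 1982, Hopes (4.11.1) ∧
(4.11.2) over number fields, linear form; `Theorems/HodgeClassesAbsolutelyTate.lean`, the typed form
of item stmt-HodgeConjecture-1815 `OgusCrystallineTate` of route `PadicSemiregularLift`) and the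
vocabulary of `Literature/AlgebraicGeometry/Motives/AbsolutelyTateClasses.lean`
(`CrystallineFrobeniusDatum.IsTateAt`, `IsAbsolutelyTate`, `absolutelyTateClasses`,
`HodgeClassesAreAbsolutelyTate P Φ n X`):

* `hodgeClassesAbsolutelyTate_iff` — the conjecture IS, by `Iff.rfl`, the assertion that every
  schema-pinned period realization `P`, every Frobenius family `Φ` and every smooth projective `X`
  satisfy the per-variety property `HodgeClassesAreAbsolutelyTate P Φ n X` (so a route may consume
  either the closed conjecture or the per-`X` hypothesis);
* `HodgeClassesAbsolutelyTate.hodgeClassesAreAbsolutelyTate`, `.isAbsolutelyTate`,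
  `.mem_absolutelyTateClasses`, `.exists_finite` — application forms (under the conjecture a de Rham
  class Hodge on the nose at some `σ` is absolutely Tate: Tate at all places of good reduction off
  a finite set);
* `hodgeClassesAbsolutelyTate_of_forall_mem_algebraicClasses` — the conjecture follows from the
  de Rham form of algebraicity of Hodge classes ("every de Rham class Hodge on the nose at some `σ`
  lies in the `k`-span of classes of `k`-rational cycles", which the Hodge conjecture gives after
  spreading out and a Galois-norm argument), by `phi_cycleClass` (Berthelot–Ogus 1983, Thm. 4.3;
  Ogus 1982, p. 364: "cohomology classes of algebraic cycles will be absolutely Tate").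

References: A. Ogus, *Hodge cycles and crystalline cohomology*, LNM 900 (1982), §4 (4.11), Thm. 4.14,
p. 364; P. Berthelot, A. Ogus, Invent. Math. 72 (1983), Thm. 4.3.
-/

set_option linter.dupNamespace false

noncomputable section

namespace Summit.HodgeConjecture.HodgeConjecture

open IsDedekindDomain
open Literature.AlgebraicGeometry.Motives
open scoped TensorProduct NumberField

/-- **Unfolding.** The conjecture `HodgeClassesAbsolutelyTate` is (definitionally) the assertion
that for every number field `k`, every period realization `P` satisfying the Hodge–Riemann
relations and hard Lefschetz, every family `Φ` of crystalline Frobenius data and every smooth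
projective `X/k` of dimension `n`, the Literature property `HodgeClassesAreAbsolutelyTate P Φ n X`
holds (Ogus 1982, (4.11.1) ∧ (4.11.2) for `X`). [cite: Ogus1982, §4 (4.11)] -/
theorem hodgeClassesAbsolutelyTate_iff :
    HodgeClassesAbsolutelyTate ↔
      ∀ ⦃k : Type⦄ [Field k] [NumberField k] (P : PeriodRealization k),
        HodgeRiemannIStatement P.B → HodgeRiemannIIStatement P.B → P.B.W.HasHardLefschetz →
        ∀ (Φ : ∀ v : HeightOneSpectrum (𝓞 k), CrystallineFrobeniusDatum P.dR v (v.adicCompletion k))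
          ⦃n : ℕ⦄ ⦃X : SchemeOver k⦄, IsSmoothProjective n X →
            HodgeClassesAreAbsolutelyTate P Φ n X :=
  Iff.rfl

namespace HodgeClassesAbsolutelyTate

variable {k : Type} [Field k] [NumberField k] {P : PeriodRealization k}
  {Φ : ∀ v : HeightOneSpectrum (𝓞 k), CrystallineFrobeniusDatum P.dR v (v.adicCompletion k)}
  {n : ℕ} {X : SchemeOver k}

/-- Application form: under the conjecture, the Hodge classes of every smooth projective `X` over a
number field are absolutely Tate (for schema-pinned `P`). [cite: Ogus1982, §4 (4.11)] -/
theorem hodgeClassesAreAbsolutelyTate (h : HodgeClassesAbsolutelyTate)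
    (hI : HodgeRiemannIStatement P.B) (hII : HodgeRiemannIIStatement P.B)
    (hL : P.B.W.HasHardLefschetz) (hX : IsSmoothProjective n X) :
    HodgeClassesAreAbsolutelyTate P Φ n X :=
  h P hI hII hL Φ hX

/-- Under the conjecture, a de Rham class `α ∈ H²ʳ_dR(X/k)` which is a Hodge class relative to
some `σ : k →+* ℂ` (on the nose) is absolutely Tate: `φ_v (1 ⊗ α) = q_vʳ (1 ⊗ α)` at all but
finitely many places of good reduction. [cite: Ogus1982, §4 (4.11)] -/
theorem isAbsolutelyTate (h : HodgeClassesAbsolutelyTate) (hI : HodgeRiemannIStatement P.B)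
    (hII : HodgeRiemannIIStatement P.B) (hL : P.B.W.HasHardLefschetz) (hX : IsSmoothProjective n X)
    {r : ℕ} {α : P.dR.obj X (2 * r)} (σ : k →+* ℂ)
    (hXσ : IsSmoothProjective n ((baseChangeHom σ).obj X)) (hα : P.IsHodgeRelativeTo σ hXσ r α) :
    IsAbsolutelyTate Φ n X r α :=
  h P hI hII hL Φ hX r α σ hXσ hα

/-- Subspace form of `isAbsolutelyTate`: the class lies in `absolutelyTateClasses Φ n X r`.
[cite: Ogus1982, §4 (4.11)] -/
theorem mem_absolutelyTateClasses (h : HodgeClassesAbsolutelyTate)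
    (hI : HodgeRiemannIStatement P.B) (hII : HodgeRiemannIIStatement P.B)
    (hL : P.B.W.HasHardLefschetz) (hX : IsSmoothProjective n X) {r : ℕ} {α : P.dR.obj X (2 * r)}
    (σ : k →+* ℂ) (hXσ : IsSmoothProjective n ((baseChangeHom σ).obj X))
    (hα : P.IsHodgeRelativeTo σ hXσ r α) : α ∈ absolutelyTateClasses Φ n X r :=
  h P hI hII hL Φ hX r α σ hXσ hα

/-- Finite-exceptional-set form (Ogus (4.4.2): "for some smooth `R/ℤ` in `k`"): under the
conjecture there is a finite set `S` of places outside which a Hodge-on-the-nose class is a Tate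
class at every place of good reduction. [cite: Ogus1982, §4 (4.4.2) and (4.11)] -/
theorem exists_finite (h : HodgeClassesAbsolutelyTate) (hI : HodgeRiemannIStatement P.B)
    (hII : HodgeRiemannIIStatement P.B) (hL : P.B.W.HasHardLefschetz) (hX : IsSmoothProjective n X)
    {r : ℕ} {α : P.dR.obj X (2 * r)} (σ : k →+* ℂ)
    (hXσ : IsSmoothProjective n ((baseChangeHom σ).obj X)) (hα : P.IsHodgeRelativeTo σ hXσ r α) :
    ∃ S : Set (HeightOneSpectrum (𝓞 k)), S.Finite ∧
      ∀ v ∉ S, HasGoodReductionAt X n v → (Φ v).IsTateAt X r α :=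
  isAbsolutelyTate_iff_exists_finite.mp (h.isAbsolutelyTate hI hII hL hX σ hXσ hα)

end HodgeClassesAbsolutelyTate

/-- **Algebraicity of Hodge classes implies the conjecture.** If for every number field `k`, every
period realization `P`, every smooth projective `X/k` and every `σ`, each de Rham class on `X`
which is a Hodge class relative to `σ` lies in the `k`-span of the classes of `k`-rational
algebraic cycles (the de Rham consequence of the Hodge conjecture for `X_σ`, after spreading out
the cycles and a Galois-norm argument), then `HodgeClassesAbsolutelyTate` holds — classes of
`k`-rational cycles being Tate at every place of good reduction (`phi_cycleClass`; Ogus 1982,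
p. 364). The pins on `P` are not needed for this direction. [cite: Ogus1982, §4, p. 364] -/
theorem hodgeClassesAbsolutelyTate_of_forall_mem_algebraicClasses
    (hHC : ∀ ⦃k : Type⦄ [Field k] [NumberField k] (P : PeriodRealization k) ⦃n : ℕ⦄
      ⦃X : SchemeOver k⦄, IsSmoothProjective n X → ∀ (r : ℕ) (α : P.dR.obj X (2 * r)) (σ : k →+* ℂ)
        (hXσ : IsSmoothProjective n ((baseChangeHom σ).obj X)),
        P.IsHodgeRelativeTo σ hXσ r α → α ∈ P.dR.algebraicClasses X r) :
    HodgeClassesAbsolutelyTate :=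
  fun _k _ _ P _hI _hII _hL _Φ _n _X hX =>
    hodgeClassesAreAbsolutelyTate_of_forall_mem_algebraicClasses hX (hHC P hX)

end Summit.HodgeConjecture.HodgeConjecture

end
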